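import Mathlib
import HarnessLib
import Summits.NavierStokesRegularity.NavierStokesRegularity.Theorems.UnthreadedDoorNetFluxOneSidedLawPointwise

/-!
# Route `UnthreadedDoor`, crux `PoloidalLiouville` (stmt-NavierStokesRegularity-1222), WALL W1 `stub_scalarLiouville` —
# crux idea «netflux-typei-gap» (ns-idea-14, LINE v7 0e37b0e5ff94): **NF-1cᵛ `stub_oneSidedLaw_of_hinges` PROVED**

Third of three files (`…OneSidedLawCalculus` ⟶ `…OneSidedLawPointwise` ⟶ this file).
`NetFlux.oneSidedNetFluxLaw_of_hinges : EnvelopeFacts → ExtremalHeadEMF → OneSidedNetFluxLaw` (statement bodies = the line's, over the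
`rfl`-twinned Theorems-side objects: `EnvelopeFacts` is the type of `NetFlux.envelopeFacts` p667268, `ExtremalHeadEMF` is in
`…UnthreadedDoorNetFluxEnvelopeDefs` p662148, `OneSidedNetFluxLaw` in `…UnthreadedDoorNetFluxViscosityDefs` p667720), so the line closes
its stub by `exact Theorems.PoloidalLiouville.NetFlux.oneSidedNetFluxLaw_of_hinges`.  The envelope facts are in fact PROVED (p667268), so
the sharper `NetFlux.oneSidedNetFluxLaw_of_extremalHeadEMF : ExtremalHeadEMF → OneSidedNetFluxLaw` is the real content: the one-sided
(viscosity-ready) transport law for the net toroidal flux `w(t,r) = r · osc_{S_r(x₀)} T(t)` follows from hinge (a) `ExtremalHeadEMF` alone.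

PROOF = the Lines docstring «Derivation of (L)», step by step:
* head `P(t,·)` from `CapSym.headPotentialExists` (FL-A, p650918) applied per time slice to `L = ∂ₜT + ⟪v,∇T⟫ − ΔT`, `m = ⟪v, x − x₀⟫`
  (`CurledLaw` is literally its hypothesis; regularity `contDiffOn_windowOperator`); the head relation gives the tangential relation
  `(∇P − m∇T) × (x − x₀) = 0`, so `ExtremalHeadEMF` yields the extremal head difference `I` with (iii) Lipschitz, (iv) `|I| ≤ V w`, (v)
  `I' ≤ sup_{argmax} ∂_rP − inf_{argmin} ∂_rP` a.e.;
* `ℓp, ℓm` = differences of the one-sided derivatives of `ρ·sphSup`, `ρ·sphInf` (p664847), `ℓm ≤ ℓp`; joint continuity (p662790/p664847);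
* POINTWISE on `[a,R]` (`netFlux_sub_netFlux_le_pointwise`, file `…OneSidedLawPointwise`): time comparison at extremisers `x̂±` chosen to attain `sup ∂_rP|argmax` /
  `inf ∂_rP|argmin` (compactness), Taylor in `t` with the NAMED constant `M₂ = sup |∂ₜ²T|` on `[t−δ₀,t] × shell(a,R)` (card v5.2 P1),
  the exact slice identity `∂ₜT = ΔT − ∂_rP/r` at extremisers, `Δ ≤ ∂_r² + (2/r)∂_r` at a max (`≥` at a min) (p669437), and the
  second-difference touching bounds (E)(c) (p667268):
  `w(t,r) − w(t−h,r) ≤ h·(Δ²_k w(t,r)/k² + 2Mk − g(r)) + 2RM₂h²`, `g = sup_{argmax}∂_rP − inf_{argmin}∂_rP`;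
* INTEGRATE over `(a,R)` (`oneSidedLaw_core`): a.e. `g ≥ I'` (hinge (v)), `integral_mono_ae`; `∫Δ²_k w = D_k(R) − D_k(a)` (p669436); FTC for
  the Lipschitz `I(t,·)` (Mathlib `LipschitzOnWith.absolutelyContinuousOnInterval` + `AbsolutelyContinuousOnInterval.integral_deriv_eq_sub`);
  `|I| ≤ V w` at `r = a, R`; `k ↓ 0` by `abs_oneSidedMean_sub_le` (p669436) and `ℓm ≤ ℓp`; `δ` with `2RM₂(R−a)δ ≤ ε/4`.

WHAT THIS IS NOT: no NS-regularity statement is touched — this is ONE registered stub (NF-1cᵛ) of a RUNG line on wall W1; the line's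
research stub NF-1a `ExtremalHeadEMF` stays OPEN, and so do `PoloidalLiouville` (1222), C⁻, W1, the rung target
`UnimodalScalarLiouvilleTypeI` and the summit.  `--supports stmt-NavierStokesRegularity-1222 --as helper`.  [folklore]
-/

noncomputable section

-- the summit and its single sub-problem share the name (CONVENTIONS §1)
set_option linter.dupNamespace false

open Set Function Filter Topology InnerProductSpace MeasureTheory
open scoped RealInnerProductSpace ContDiff NNReal

namespace Summit.NavierStokesRegularity.NavierStokesRegularity.Theorems.PoloidalLiouville.NetFlux

open Literature.Analysis Literature.Analysis.FluidPDE

variable {v : ℝ → E3 → E3} {T : ℝ → E3 → ℝ} {x₀ : E3} {t₀ : ℝ} {V : ℝ → ℝ}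

/-! ### Integration over `(a, R)` and the limit `k ↓ 0` -/

/-- **The one-sided law for fixed `t`, `0 < a < R`, `ε > 0`** (fourth conjunct of `OneSidedNetFluxLaw`), from the head relation on the
window, the extremal head difference `I` of `ExtremalHeadEMF` (Lipschitz in `r`, `|I| ≤ V w`, `I' ≤ sup_{argmax}∂_rP − inf_{argmin}∂_rP`
a.e.) and the one-sided derivatives `ℓm ≤ ℓp` of `w(t,·)`: integrate the pointwise inequality over `(a,R)` (a.e. upgrade `g ≥ I'`,
`integral_mono_ae`, `∫Δ²_k w = D_k(R) − D_k(a)`, FTC for the Lipschitz `I`), then let `k ↓ 0` (`D_k/k² → (ℓp+ℓm)/2`, `ℓm ≤ ℓp`) and take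
`δ` with `2RM₂(R−a)δ ≤ ε/4`. [folklore] -/
theorem oneSidedLaw_core
    (hT : ContDiffOn ℝ (⊤ : ℕ∞) (uncurry T) (Ioo t₀ 0 ×ˢ ({x₀}ᶜ : Set E3)))
    {P : ℝ → E3 → ℝ} (hP1 : ∀ t ∈ Ioo t₀ 0, ContDiffOn ℝ 1 (P t) ({x₀}ᶜ : Set E3))
    (hhead : ∀ t ∈ Ioo t₀ 0, ∀ x, x ≠ x₀ →
        (deriv (fun σ => T σ x) t + ⟪v t x, gradient (T t) x⟫ - Laplacian.laplacian (T t) x) • (x - x₀)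
          = ⟪v t x, x - x₀⟫ • gradient (T t) x - gradient (P t) x)
    {I : ℝ → ℝ → ℝ}
    (hILip : ∀ t ∈ Ioo t₀ 0, ∀ a b : ℝ, 0 < a → a < b → ∃ L : NNReal, LipschitzOnWith L (I t) (Icc a b))
    (hIbd : ∀ t ∈ Ioo t₀ 0, ∀ r > 0, |I t r| ≤ V t * netFlux (T t) x₀ r)
    (hIderiv : ∀ t ∈ Ioo t₀ 0, ∀ᵐ r : ℝ, 0 < r →
        deriv (I t) r ≤ sSup (radDeriv (P t) x₀ '' sphArgmax (T t) x₀ r)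
                        - sInf (radDeriv (P t) x₀ '' sphArgmin (T t) x₀ r))
    {ℓp ℓm : ℝ → ℝ → ℝ}
    (hℓ : ∀ t ∈ Ioo t₀ 0, ∀ r > 0, HasDerivWithinAt (fun ρ => netFlux (T t) x₀ ρ) (ℓp t r) (Ioi r) r ∧
        HasDerivWithinAt (fun ρ => netFlux (T t) x₀ ρ) (ℓm t r) (Iio r) r ∧ ℓm t r ≤ ℓp t r)
    {t : ℝ} (ht : t ∈ Ioo t₀ 0) {a R : ℝ} (ha : 0 < a) (haR : a < R) {ε : ℝ} (hε : 0 < ε) :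
    ∃ δ > 0, ∀ h ∈ Ioo 0 δ,
      (∫ r in Ioo a R, netFlux (T t) x₀ r) - (∫ r in Ioo a R, netFlux (T (t - h)) x₀ r)
        ≤ h * (ℓp t R - ℓm t a + V t * (netFlux (T t) x₀ R + netFlux (T t) x₀ a) + ε) := by
  have hR0 : 0 < R := ha.trans haR
  have hwc : ContinuousOn (fun ρ => netFlux (T t) x₀ ρ) (Ioi 0) := continuousOn_netFlux_slice hT.continuousOn ht
  -- (E)(c): the touching constants `M, k₀`
  obtain ⟨M, k₀, hk₀, hk₀a, hEc⟩ := exists_secondDiff_touching hT ht ha (R := R)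
  -- Taylor in time: `δ₀, M₂`
  obtain ⟨δ₀, M₂, hδ₀, htδ₀, hM₂, htaylor⟩ := exists_time_taylor_bound hT ht ha R
  -- one-sided derivatives at `R` and at `a`
  obtain ⟨hpR, hmR, hleR⟩ := hℓ t ht R hR0
  obtain ⟨hpa, hma, hlea⟩ := hℓ t ht a ha
  have hε4 : 0 < ε / 4 := by positivity
  -- the choice of `k`: one-sided means within `ε/4`, `2Mk(R−a) ≤ ε/4`, `k < k₀`
  have evR := abs_oneSidedMean_sub_le (k₀ := R / 2) (by positivity)
    (hwc.mono fun ρ hρ => mem_Ioi.2 (by linarith [hρ.1])) hpR hmR (ε / 4) hε4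
  have eva := abs_oneSidedMean_sub_le (k₀ := a / 2) (by positivity)
    (hwc.mono fun ρ hρ => mem_Ioi.2 (by linarith [hρ.1])) hpa hma (ε / 4) hε4
  have evM : ∀ᶠ k in 𝓝[>] (0 : ℝ), 2 * M * k * (R - a) ≤ ε / 4 := by
    have hc : Continuous fun k : ℝ => 2 * M * k * (R - a) := by fun_prop
    have h0 : Tendsto (fun k : ℝ => 2 * M * k * (R - a)) (𝓝 0) (𝓝 0) := by
      have h := hc.continuousAt (x := (0 : ℝ))
      rw [ContinuousAt, mul_zero, zero_mul] at h
      exact h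
    exact (tendsto_nhdsWithin_of_tendsto_nhds h0 |>.eventually (gt_mem_nhds hε4)).mono fun k hk => hk.le
  have evk : ∀ᶠ k in 𝓝[>] (0 : ℝ), k ∈ Ioo 0 k₀ := Ioo_mem_nhdsGT hk₀
  obtain ⟨k, hkR, hka, hkM, hk⟩ := (evR.and (eva.and (evM.and evk))).exists
  -- the choice of `δ`
  set C₂ : ℝ := 2 * R * M₂ * (R - a) with hC₂
  have hC₂0 : 0 ≤ C₂ := mul_nonneg (mul_nonneg (mul_nonneg two_pos.le hR0.le) hM₂) (sub_nonneg.2 haR.le)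
  have h4C : 0 < 4 * (C₂ + 1) := by positivity
  refine ⟨min δ₀ (ε / (4 * (C₂ + 1))), lt_min hδ₀ (by positivity), fun h hh => ?_⟩
  have hh0 : 0 < h := hh.1
  have hhδ₀ : h < δ₀ := lt_of_lt_of_le hh.2 (min_le_left _ _)
  have hhε : h ≤ ε / (4 * (C₂ + 1)) := (lt_of_lt_of_le hh.2 (min_le_right _ _)).le
  have hsI : t - h ∈ Icc (t - δ₀) t := ⟨by linarith, by linarith⟩
  have hsw : t - h ∈ Ioo t₀ 0 := ⟨by linarith, by linarith [ht.2]⟩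
  have hw'c : ContinuousOn (fun ρ => netFlux (T (t - h)) x₀ ρ) (Ioi 0) :=
    continuousOn_netFlux_slice hT.continuousOn hsw
  have htaylor' : ∀ x : E3, ‖x - x₀‖ ∈ Icc a R →
      |T t x - T (t - h) x - h * deriv (fun σ => T σ x) t| ≤ M₂ * h ^ 2 := by
    intro x hx
    have h1 := htaylor (t - h) hsI x hx
    rwa [show t - (t - h) = h by ring] at h1
  -- the pointwise inequality on `[a,R]`
  have hpt : ∀ r ∈ Icc a R,
      netFlux (T t) x₀ r - netFlux (T (t - h)) x₀ r
        ≤ h * ((netFlux (T t) x₀ (r + k) - 2 * netFlux (T t) x₀ r + netFlux (T t) x₀ (r - k)) / k ^ 2 + 2 * M * k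
              - (sSup (radDeriv (P t) x₀ '' sphArgmax (T t) x₀ r) - sInf (radDeriv (P t) x₀ '' sphArgmin (T t) x₀ r)))
          + 2 * R * M₂ * h ^ 2 := by
    intro r hr
    obtain ⟨hEsup, hEinf⟩ := hEc k hk r hr
    exact netFlux_sub_netFlux_le_pointwise hT ht hsw (hP1 t ht) (hhead t ht) ha hh0 hM₂ htaylor' hr hEsup hEinf
  -- its a.e. upgrade with `I'` in place of `g`
  set Φ : ℝ → ℝ := fun r =>
    h * ((netFlux (T t) x₀ (r + k) - 2 * netFlux (T t) x₀ r + netFlux (T t) x₀ (r - k)) / k ^ 2 + 2 * M * k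
          - deriv (I t) r) + 2 * R * M₂ * h ^ 2 with hΦ
  have hae : ∀ᵐ r ∂(volume.restrict (Ioo a R)),
      (fun r => netFlux (T t) x₀ r - netFlux (T (t - h)) x₀ r) r ≤ Φ r := by
    rw [ae_restrict_iff' measurableSet_Ioo]
    filter_upwards [hIderiv t ht] with r hr hrI
    have hr0 : 0 < r := ha.trans hrI.1
    have h1 := hpt r (Ioo_subset_Icc_self hrI)
    have h2 := hr hr0
    have h3 : h * ((netFlux (T t) x₀ (r + k) - 2 * netFlux (T t) x₀ r + netFlux (T t) x₀ (r - k)) / k ^ 2 + 2 * M * k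
              - (sSup (radDeriv (P t) x₀ '' sphArgmax (T t) x₀ r) - sInf (radDeriv (P t) x₀ '' sphArgmin (T t) x₀ r)))
        ≤ h * ((netFlux (T t) x₀ (r + k) - 2 * netFlux (T t) x₀ r + netFlux (T t) x₀ (r - k)) / k ^ 2 + 2 * M * k
              - deriv (I t) r) := mul_le_mul_of_nonneg_left (by linarith) hh0.le
    show netFlux (T t) x₀ r - netFlux (T (t - h)) x₀ r ≤ Φ r
    simp only [hΦ]
    linarith
  -- integrability of everything on `(a,R)`
  have hwI : IntegrableOn (fun ρ => netFlux (T t) x₀ ρ) (Ioo a R) := integrableOn_Ioo_of_continuousOn_Ioi hwc ha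
  have hw'I : IntegrableOn (fun ρ => netFlux (T (t - h)) x₀ ρ) (Ioo a R) := integrableOn_Ioo_of_continuousOn_Ioi hw'c ha
  obtain ⟨L, hL⟩ := hILip t ht a R ha haR
  obtain ⟨hIftc, hIint⟩ := integral_Ioo_deriv_eq_sub_of_lipschitzOnWith haR.le hL
  have hshiftp : ContinuousOn (fun r => netFlux (T t) x₀ (r + k)) (Icc a R) :=
    hwc.comp (continuousOn_id.add continuousOn_const) fun r hr => mem_Ioi.2 (by linarith [hr.1, hk.1])
  have hshiftm : ContinuousOn (fun r => netFlux (T t) x₀ (r - k)) (Icc a R) :=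
    hwc.comp (continuousOn_id.sub continuousOn_const) fun r hr => mem_Ioi.2 (by linarith [hr.1, hk.2])
  have hwIcc : ContinuousOn (fun ρ => netFlux (T t) x₀ ρ) (Icc a R) := hwc.mono fun r hr => mem_Ioi.2 (ha.trans_le hr.1)
  have hD2c : ContinuousOn
      (fun r => netFlux (T t) x₀ (r + k) - 2 * netFlux (T t) x₀ r + netFlux (T t) x₀ (r - k)) (Icc a R) :=
    (hshiftp.sub (continuousOn_const.mul hwIcc)).add hshiftm
  have hD2I : IntegrableOn
      (fun r => netFlux (T t) x₀ (r + k) - 2 * netFlux (T t) x₀ r + netFlux (T t) x₀ (r - k)) (Ioo a R) :=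
    hD2c.integrableOn_Icc.mono_set Ioo_subset_Icc_self
  have hD2I' : IntegrableOn
      (fun r => (netFlux (T t) x₀ (r + k) - 2 * netFlux (T t) x₀ r + netFlux (T t) x₀ (r - k)) / k ^ 2) (Ioo a R) :=
    (hD2c.div_const _).integrableOn_Icc.mono_set Ioo_subset_Icc_self
  have hcI : ∀ c : ℝ, IntegrableOn (fun _ : ℝ => c) (Ioo a R) := fun c =>
    (continuousOn_const (c := c)).integrableOn_Icc.mono_set Ioo_subset_Icc_self
  have hinner : IntegrableOn
      (fun r => (netFlux (T t) x₀ (r + k) - 2 * netFlux (T t) x₀ r + netFlux (T t) x₀ (r - k)) / k ^ 2 + 2 * M * k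
          - deriv (I t) r) (Ioo a R) := (hD2I'.add (hcI _)).sub hIint
  have hΦI : IntegrableOn Φ (Ioo a R) := (hinner.const_mul h).add (hcI _)
  -- integrate
  have hmono := integral_mono_ae (μ := volume.restrict (Ioo a R))
    (f := fun r => netFlux (T t) x₀ r - netFlux (T (t - h)) x₀ r) (hwI.sub hw'I) hΦI hae
  rw [integral_sub hwI hw'I] at hmono
  -- evaluate `∫ Φ`
  have hvol : (volume : Measure ℝ).real (Ioo a R) = R - a := Real.volume_real_Ioo_of_le haR.le
  have hΦeq : ∫ r in Ioo a R, Φ r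
      = h * ((∫ r in Ioo a R, (netFlux (T t) x₀ (r + k) - 2 * netFlux (T t) x₀ r + netFlux (T t) x₀ (r - k)) / k ^ 2)
              + 2 * M * k * (R - a) - (I t R - I t a)) + 2 * R * M₂ * h ^ 2 * (R - a) := by
    have i1 : ∫ r in Ioo a R, Φ r
        = (∫ r in Ioo a R, h * ((netFlux (T t) x₀ (r + k) - 2 * netFlux (T t) x₀ r + netFlux (T t) x₀ (r - k)) / k ^ 2
            + 2 * M * k - deriv (I t) r)) + ∫ _ in Ioo a R, (2 * R * M₂ * h ^ 2 : ℝ) :=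
      integral_add (f := fun r => h * ((netFlux (T t) x₀ (r + k) - 2 * netFlux (T t) x₀ r + netFlux (T t) x₀ (r - k)) / k ^ 2
            + 2 * M * k - deriv (I t) r)) (g := fun _ => 2 * R * M₂ * h ^ 2) (hinner.const_mul h) (hcI _)
    have i2 : ∫ r in Ioo a R, h * ((netFlux (T t) x₀ (r + k) - 2 * netFlux (T t) x₀ r + netFlux (T t) x₀ (r - k)) / k ^ 2
            + 2 * M * k - deriv (I t) r)
        = h * ∫ r in Ioo a R, ((netFlux (T t) x₀ (r + k) - 2 * netFlux (T t) x₀ r + netFlux (T t) x₀ (r - k)) / k ^ 2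
            + 2 * M * k - deriv (I t) r) := integral_const_mul _ _
    have i3 : ∫ r in Ioo a R, ((netFlux (T t) x₀ (r + k) - 2 * netFlux (T t) x₀ r + netFlux (T t) x₀ (r - k)) / k ^ 2
            + 2 * M * k - deriv (I t) r)
        = (∫ r in Ioo a R, ((netFlux (T t) x₀ (r + k) - 2 * netFlux (T t) x₀ r + netFlux (T t) x₀ (r - k)) / k ^ 2
            + 2 * M * k)) - ∫ r in Ioo a R, deriv (I t) r :=
      integral_sub (f := fun r => (netFlux (T t) x₀ (r + k) - 2 * netFlux (T t) x₀ r + netFlux (T t) x₀ (r - k)) / k ^ 2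
            + 2 * M * k) (g := fun r => deriv (I t) r) (hD2I'.add (hcI _)) hIint
    have i4 : ∫ r in Ioo a R, ((netFlux (T t) x₀ (r + k) - 2 * netFlux (T t) x₀ r + netFlux (T t) x₀ (r - k)) / k ^ 2
            + 2 * M * k)
        = (∫ r in Ioo a R, (netFlux (T t) x₀ (r + k) - 2 * netFlux (T t) x₀ r + netFlux (T t) x₀ (r - k)) / k ^ 2)
            + ∫ _ in Ioo a R, (2 * M * k : ℝ) :=
      integral_add (f := fun r => (netFlux (T t) x₀ (r + k) - 2 * netFlux (T t) x₀ r + netFlux (T t) x₀ (r - k)) / k ^ 2)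
        (g := fun _ => 2 * M * k) hD2I' (hcI _)
    have i5 : ∫ _ in Ioo a R, (2 * M * k : ℝ) = 2 * M * k * (R - a) := by
      rw [setIntegral_const, hvol, smul_eq_mul]; ring
    have i6 : ∫ _ in Ioo a R, (2 * R * M₂ * h ^ 2 : ℝ) = 2 * R * M₂ * h ^ 2 * (R - a) := by
      rw [setIntegral_const, hvol, smul_eq_mul]; ring
    rw [i1, i2, i3, i4, i5, i6, hIftc]
  -- the second differences under the integral
  have hD2eq : ∫ r in Ioo a R, (netFlux (T t) x₀ (r + k) - 2 * netFlux (T t) x₀ r + netFlux (T t) x₀ (r - k)) / k ^ 2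
      = (((∫ r in R..R + k, netFlux (T t) x₀ r) - ∫ r in R - k..R, netFlux (T t) x₀ r)
          - ((∫ r in a..a + k, netFlux (T t) x₀ r) - ∫ r in a - k..a, netFlux (T t) x₀ r)) / k ^ 2 := by
    rw [integral_div, integral_Ioo_eq_intervalIntegral_of_le haR.le,
      intervalIntegral_secondDiff_eq hk.1.le haR.le (hwc.mono fun r hr => mem_Ioi.2 (by linarith [hr.1, hk.2]))]
  -- the `k`-terms: one-sided means and `ℓm ≤ ℓp`
  have hkR' := (abs_le.1 hkR).2
  have hka' := (abs_le.1 hka).1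
  have hIR := (abs_le.1 (hIbd t ht R hR0))
  have hIa := (abs_le.1 (hIbd t ht a ha))
  -- the `h²`-term
  have hC₂h : C₂ * h ≤ ε / 4 := by
    calc C₂ * h ≤ C₂ * (ε / (4 * (C₂ + 1))) := mul_le_mul_of_nonneg_left hhε hC₂0
      _ = ε * C₂ / (4 * (C₂ + 1)) := by ring
      _ ≤ ε / 4 := by
          rw [div_le_div_iff₀ h4C (by norm_num : (0 : ℝ) < 4)]
          nlinarith [hε, hC₂0]
  -- conclude
  have hbr : (((∫ r in R..R + k, netFlux (T t) x₀ r) - ∫ r in R - k..R, netFlux (T t) x₀ r)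
          - ((∫ r in a..a + k, netFlux (T t) x₀ r) - ∫ r in a - k..a, netFlux (T t) x₀ r)) / k ^ 2
        + 2 * M * k * (R - a) - (I t R - I t a)
      ≤ ℓp t R - ℓm t a + V t * (netFlux (T t) x₀ R + netFlux (T t) x₀ a) + 3 * (ε / 4) := by
    rw [sub_div]
    linarith [hkR', hka', hleR, hlea, hIR.1, hIa.2, hkM]
  have hfin := mul_le_mul_of_nonneg_left hbr hh0.le
  have hsq : 2 * R * M₂ * h ^ 2 * (R - a) = (C₂ * h) * h := by simp only [hC₂]; ring
  have hsq' : (C₂ * h) * h ≤ (ε / 4) * h := mul_le_mul_of_nonneg_right hC₂h hh0.le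
  calc (∫ r in Ioo a R, netFlux (T t) x₀ r) - (∫ r in Ioo a R, netFlux (T (t - h)) x₀ r)
      ≤ ∫ r in Ioo a R, Φ r := hmono
    _ = h * ((((∫ r in R..R + k, netFlux (T t) x₀ r) - ∫ r in R - k..R, netFlux (T t) x₀ r)
          - ((∫ r in a..a + k, netFlux (T t) x₀ r) - ∫ r in a - k..a, netFlux (T t) x₀ r)) / k ^ 2
              + 2 * M * k * (R - a) - (I t R - I t a)) + (C₂ * h) * h := by rw [hΦeq, hD2eq, hsq]
    _ ≤ h * (ℓp t R - ℓm t a + V t * (netFlux (T t) x₀ R + netFlux (T t) x₀ a) + 3 * (ε / 4)) + (ε / 4) * h :=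
          add_le_add hfin hsq'
    _ = h * (ℓp t R - ℓm t a + V t * (netFlux (T t) x₀ R + netFlux (T t) x₀ a) + ε) := by ring

/-! ### Assembly -/

/-- **NF-1cᵛ from hinge (a) alone**: `ExtremalHeadEMF → OneSidedNetFluxLaw` (the envelope facts (E) are theorems, p667268/p664847/p662790, so
they are used directly rather than assumed).  Head from FL-A per slice; `I` from `ExtremalHeadEMF`; `ℓp, ℓm` from the one-sided derivatives
of the envelopes; the law from `oneSidedLaw_core`. [folklore] -/
theorem oneSidedNetFluxLaw_of_extremalHeadEMF (hA : ExtremalHeadEMF) : OneSidedNetFluxLaw := by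
  intro v x₀ T V t₀ hv hT hV hE1 huni
  -- the head potential and the extremal head difference
  obtain ⟨P, hP1, hhead⟩ := exists_headPotential hv hT hE1
  have htan : ∀ t ∈ Ioo t₀ 0, ∀ x, x ≠ x₀ →
      cross (gradient (P t) x - (inner ℝ (v t x) (x - x₀)) • gradient (T t) x) (x - x₀) = 0 :=
    fun t ht x hx => cross_sub_smul_eq_zero_of_head (hhead t ht x hx)
  obtain ⟨I, -, -, hILip, hIbd, hIderiv⟩ := hA v x₀ T P V t₀ hv hT hP1 hV htan huni
  -- the one-sided derivatives of `w`
  have hex : ∀ t r : ℝ, ∃ lp lm : ℝ, t ∈ Ioo t₀ 0 → 0 < r →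
      HasDerivWithinAt (fun ρ => netFlux (T t) x₀ ρ) lp (Ioi r) r ∧
        HasDerivWithinAt (fun ρ => netFlux (T t) x₀ ρ) lm (Iio r) r ∧ lm ≤ lp := by
    intro t r
    by_cases ht : t ∈ Ioo t₀ 0
    · by_cases hr : 0 < r
      · obtain ⟨lp, lm, hp, hm, hle⟩ := exists_oneSided_deriv_netFlux hT ht hr
        exact ⟨lp, lm, fun _ _ => ⟨hp, hm, hle⟩⟩
      · exact ⟨0, 0, fun _ h => absurd h hr⟩
    · exact ⟨0, 0, fun h _ => absurd h ht⟩
  choose ℓp ℓm hℓ using hex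
  refine ⟨ℓp, ℓm, continuousOn_netFlux_family hT.continuousOn, fun t ht r hr => (hℓ t r ht hr).1,
    fun t ht r hr => (hℓ t r ht hr).2.1, fun t ht a R ha haR ε hε => ?_⟩
  exact oneSidedLaw_core hT hP1 hhead hILip hIbd hIderiv (fun t ht r hr => hℓ t r ht hr) ht ha haR hε

/-- **`NetFlux.oneSidedNetFluxLaw_of_hinges` (LINE v7 «netflux-typei-gap», NF-1cᵛ), proved** — the line's stub
`stub_oneSidedLaw_of_hinges : EnvelopeFacts → ExtremalHeadEMF → OneSidedNetFluxLaw` with `EnvelopeFacts` spelled out as the verbatim body of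
the line's `def EnvelopeFacts` (= the type of `NetFlux.envelopeFacts`, p667268) over the `rfl`-twinned Theorems-side objects, so that in the
line `theorem stub_oneSidedLaw_of_hinges : EnvelopeFacts → ExtremalHeadEMF → OneSidedNetFluxLaw :=
Theorems.PoloidalLiouville.NetFlux.oneSidedNetFluxLaw_of_hinges` (definitional unfolding).  The (E) hypothesis is not needed (the envelope
facts are proved, p667268); the content is `oneSidedNetFluxLaw_of_extremalHeadEMF`.  No NS statement is involved; NF-1a `ExtremalHeadEMF`
stays OPEN. [folklore] -/
theorem oneSidedNetFluxLaw_of_hinges :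
    (∀ (T : ℝ → E3 → ℝ) (x₀ : E3) (t₀ : ℝ),
      ContDiffOn ℝ (⊤ : ℕ∞) (uncurry T) (Ioo t₀ 0 ×ˢ ({x₀}ᶜ : Set E3)) →
        ContinuousOn (fun p : ℝ × ℝ => sphSup (T p.1) x₀ p.2) (Ioo t₀ 0 ×ˢ Ioi 0) ∧
        ContinuousOn (fun p : ℝ × ℝ => sphInf (T p.1) x₀ p.2) (Ioo t₀ 0 ×ˢ Ioi 0) ∧
        (∀ t ∈ Ioo t₀ 0, ∀ r > 0, ∃ dp dm : ℝ,
            HasDerivWithinAt (fun ρ => ρ * sphSup (T t) x₀ ρ) dp (Ioi r) r ∧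
            HasDerivWithinAt (fun ρ => ρ * sphSup (T t) x₀ ρ) dm (Iio r) r ∧ dm ≤ dp) ∧
        (∀ t ∈ Ioo t₀ 0, ∀ r > 0, ∃ dp dm : ℝ,
            HasDerivWithinAt (fun ρ => ρ * sphInf (T t) x₀ ρ) dp (Ioi r) r ∧
            HasDerivWithinAt (fun ρ => ρ * sphInf (T t) x₀ ρ) dm (Iio r) r ∧ dp ≤ dm) ∧
        (∀ t ∈ Ioo t₀ 0, ∀ a R : ℝ, 0 < a → a ≤ R → ∃ M k₀ : ℝ, 0 < k₀ ∧ k₀ < a ∧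
            ∀ k ∈ Ioo 0 k₀, ∀ r ∈ Icc a R,
              (∀ x ∈ sphArgmax (T t) x₀ r,
                  r * radDeriv2 (T t) x₀ x + 2 * radDeriv (T t) x₀ x
                    ≤ ((r + k) * sphSup (T t) x₀ (r + k) - 2 * (r * sphSup (T t) x₀ r)
                        + (r - k) * sphSup (T t) x₀ (r - k)) / k ^ 2 + M * k) ∧
              (∀ x ∈ sphArgmin (T t) x₀ r,
                  ((r + k) * sphInf (T t) x₀ (r + k) - 2 * (r * sphInf (T t) x₀ r)
                      + (r - k) * sphInf (T t) x₀ (r - k)) / k ^ 2 - M * k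
                    ≤ r * radDeriv2 (T t) x₀ x + 2 * radDeriv (T t) x₀ x))) →
    ExtremalHeadEMF → OneSidedNetFluxLaw :=
  fun _ hA => oneSidedNetFluxLaw_of_extremalHeadEMF hA

end Summit.NavierStokesRegularity.NavierStokesRegularity.Theorems.PoloidalLiouville.NetFlux

end
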